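import Summits.ValiantsHypothesis.ValiantsHypothesis.Theorems.LacunarySymmetroidMatrixDescartesDoorA26ClosureTwoRows
import Summits.ValiantsHypothesis.ValiantsHypothesis.Theorems.LacunarySymmetroidMatrixDescartesCensusChamber875
import Summits.ValiantsHypothesis.ValiantsHypothesis.Theorems.LacunarySymmetroidMatrixDescartesCensusChamber1351

/-!
# `DoorA26` — (M) / wall facets FROM TWO CHAMBER ROWS: a decidable facet check turns an adjacent certified pair into a wall closure statement

HONEST FRAMING.  Object-search cell `pub-symmetroid`, door-A target `DoorA26 := PosRootLawAt 2 6 19`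
(stmt-ValiantsHypothesis-19979; OPEN, typed, never asserted).  Seat val-sym-door-p2 g16 (#7).  Corollary of #4
`not_mem_closure_twentyLocus_of_twoChambers` (`…DoorA26ClosureTwoRows`); decides nothing about the door.

THE SCHEMA (`wallFacet_not_mem_closure_of_chambers`).  Two chamber ids `n₁, n₂` and a position `t₀ : Fin 20` with THREE table-side
conditions, all `decide`-able: `chamber n₂ = chamber n₁ ∘ swap(t₀, t₀+1)` (adjacent across one wall), `chamber n₁` lists canonical pairs,
`chamber n₁` is injective.  Then the two kernel rows give: every monotone `δ₀` whose pair sums increase weakly along `chamber n₁`, are TIED at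
`t₀` (the wall) and have NO OTHER TIE among the 21 entries (a value-generic point of that wall facet) lies outside `closure TwentyLocus`.
This is the line's obligation (M) `stub_mixedWalls` (resp. the disjoint-wall statement) ON THAT FACET, with no second-order sieve.
Instantiation = `by decide` ×3 + two row names; the worked instance below is the MIXED wall `2δ₁ = δ₀ + δ₃` between the certified
chambers 875 and 1351 (`doorA26_on_chamber875/1351`, tree).  Located scope (memo `CLOSURE-CENSUS-g16.md`, evidence on 19979):
1 292 of the 4 640 mixed-wall facets and 901 of the 2 238 disjoint-wall facets of theory g6's table have both sides certified today.

`DoorA26`, (W), (M), (R), `MatrixDescartes` (stmt-ValiantsHypothesis-18050) OPEN; registers unchanged; nothing on `VP ≠ VNP`.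
`--supports stmt-ValiantsHypothesis-19979 --as helper`.

[folklore] Elementary bookkeeping; no citation exists or is needed.
-/

-- `Summit.ValiantsHypothesis.ValiantsHypothesis.…` repeats a component by the D-0017 layout
-- (single-conjunct summit), which the `dupNamespace` linter flags; the name is mandated.
set_option linter.dupNamespace false

namespace Summit.ValiantsHypothesis.ValiantsHypothesis.Theorems.LacunarySymmetroidMatrixDescartes.Census.RealExp

open Summit.ValiantsHypothesis.ValiantsHypothesis.Theorems.LacunarySymmetroidMatrixDescartes.WallBubbling

/-- Positions `t.castSucc, t.succ` (`t ≠ t₀`) are never the wall pair `{t₀.castSucc, t₀.succ}` nor equal. [folklore] -/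
theorem consecutive_ne_wallPair (t₀ t : Fin 20) (ht : t ≠ t₀) (a b : Fin 21) (ha : a = t.castSucc) (hb : b = t.succ) :
    ¬ (a = b ∨ (a = t₀.castSucc ∧ b = t₀.succ) ∨ (a = t₀.succ ∧ b = t₀.castSucc)) := by
  subst ha; subst hb
  rintro (h | ⟨h1, -⟩ | ⟨h1, h2⟩)
  · exact t.castSucc_lt_succ.ne h
  · exact ht (Fin.castSucc_injective _ h1)
  · have e1 := congrArg Fin.val h1
    have e2 := congrArg Fin.val h2
    simp only [Fin.val_castSucc, Fin.val_succ] at e1 e2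
    omega

/-- **WALL FACET FROM TWO CHAMBER ROWS — the schema.**  Table-side (decidable): adjacency `hswap`, canonicity, injectivity; rows `hrow₁`,
`hrow₂`; point-side: `δ₀` monotone, in the closed cone of chamber `n₁`, tied exactly at the wall position `t₀` (`hgen`: no other tie among
the 21 entries).  Conclusion `δ₀ ∉ closure TwentyLocus`. [this work] -/
theorem wallFacet_not_mem_closure_of_chambers (n₁ n₂ : ℕ) (t₀ : Fin 20)
    (hswap : chamber n₂ = chamber n₁ ∘ Equiv.swap t₀.castSucc t₀.succ)
    (hcanon : ∀ t, (chamber n₁ t).1 ≤ (chamber n₁ t).2) (hinj : Function.Injective (chamber n₁))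
    (hrow₁ : ∀ d : Fin 6 → ℕ, StrictMono ((fun p : Fin 6 × Fin 6 => d p.1 + d p.2) ∘ chamber n₁) → PosRootLawOn 2 6 19 d)
    (hrow₂ : ∀ d : Fin 6 → ℕ, StrictMono ((fun p : Fin 6 × Fin 6 => d p.1 + d p.2) ∘ chamber n₂) → PosRootLawOn 2 6 19 d)
    (δ₀ : Fin 6 → ℝ) (hδ₀ : Monotone δ₀)
    (hmono : Monotone ((fun p : Fin 6 × Fin 6 => δ₀ p.1 + δ₀ p.2) ∘ chamber n₁))
    (htie : δ₀ (chamber n₁ t₀.castSucc).1 + δ₀ (chamber n₁ t₀.castSucc).2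
        = δ₀ (chamber n₁ t₀.succ).1 + δ₀ (chamber n₁ t₀.succ).2)
    (hgen : ∀ a b : Fin 21, δ₀ (chamber n₁ a).1 + δ₀ (chamber n₁ a).2 = δ₀ (chamber n₁ b).1 + δ₀ (chamber n₁ b).2 →
      a = b ∨ (a = t₀.castSucc ∧ b = t₀.succ) ∨ (a = t₀.succ ∧ b = t₀.castSucc)) :
    δ₀ ∉ closure {δ : Fin 6 → ℝ | ∃ S : Fin 6 → Matrix (Fin 2) (Fin 2) ℝ, (∀ l, (S l).IsSymm) ∧
      20 ≤ {x : ℝ | 0 < x ∧ (∑ l, (x ^ (δ l)) • S l).det = 0}.ncard} := by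
  have hne : chamber n₁ t₀.castSucc ≠ chamber n₁ t₀.succ :=
    fun h => t₀.castSucc_lt_succ.ne (hinj h)
  refine not_mem_closure_twentyLocus_of_twoChambers δ₀ hδ₀ n₁ n₂ t₀ hswap hcanon hmono htie hne ?_ ?_ hrow₁ hrow₂
  · intro t ht heq
    exact absurd (hgen _ _ heq) (consecutive_ne_wallPair t₀ t ht _ _ rfl rfl)
  · intro t ht heq
    rw [hswap] at heq
    simp only [Function.comp_apply] at heq
    exfalso
    rcases hgen _ _ heq with h | ⟨h1, h2⟩ | ⟨h1, -⟩
    · exact t.castSucc_lt_succ.ne ((Equiv.swap t₀.castSucc t₀.succ).injective h)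
    · rw [Equiv.apply_eq_iff_eq_symm_apply, Equiv.symm_swap, Equiv.swap_apply_left] at h1
      rw [Equiv.apply_eq_iff_eq_symm_apply, Equiv.symm_swap, Equiv.swap_apply_right] at h2
      exact consecutive_ne_wallPair t₀ t ht _ _ rfl rfl (Or.inr (Or.inr ⟨h1, h2⟩))
    · rw [Equiv.apply_eq_iff_eq_symm_apply, Equiv.symm_swap, Equiv.swap_apply_right] at h1
      exact ht (Fin.castSucc_injective _ h1)

/-- **W-line spelling** (`Bubbling.TwentyLocus`) — (M) `stub_mixedWalls` / the disjoint-wall law ON ONE FACET from two rows. [this work] -/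
theorem wallFacet_not_mem_closure_bubblingTwentyLocus_of_chambers (n₁ n₂ : ℕ) (t₀ : Fin 20)
    (hswap : chamber n₂ = chamber n₁ ∘ Equiv.swap t₀.castSucc t₀.succ)
    (hcanon : ∀ t, (chamber n₁ t).1 ≤ (chamber n₁ t).2) (hinj : Function.Injective (chamber n₁))
    (hrow₁ : ∀ d : Fin 6 → ℕ, StrictMono ((fun p : Fin 6 × Fin 6 => d p.1 + d p.2) ∘ chamber n₁) → PosRootLawOn 2 6 19 d)
    (hrow₂ : ∀ d : Fin 6 → ℕ, StrictMono ((fun p : Fin 6 × Fin 6 => d p.1 + d p.2) ∘ chamber n₂) → PosRootLawOn 2 6 19 d)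
    (δ₀ : Fin 6 → ℝ) (hδ₀ : Monotone δ₀)
    (hmono : Monotone ((fun p : Fin 6 × Fin 6 => δ₀ p.1 + δ₀ p.2) ∘ chamber n₁))
    (htie : δ₀ (chamber n₁ t₀.castSucc).1 + δ₀ (chamber n₁ t₀.castSucc).2
        = δ₀ (chamber n₁ t₀.succ).1 + δ₀ (chamber n₁ t₀.succ).2)
    (hgen : ∀ a b : Fin 21, δ₀ (chamber n₁ a).1 + δ₀ (chamber n₁ a).2 = δ₀ (chamber n₁ b).1 + δ₀ (chamber n₁ b).2 →
      a = b ∨ (a = t₀.castSucc ∧ b = t₀.succ) ∨ (a = t₀.succ ∧ b = t₀.castSucc)) :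
    δ₀ ∉ closure Bubbling.TwentyLocus :=
  wallFacet_not_mem_closure_of_chambers n₁ n₂ t₀ hswap hcanon hinj hrow₁ hrow₂ δ₀ hδ₀ hmono htie hgen

/-- **Worked instance: the MIXED wall `2δ₁ = δ₀ + δ₃` between chambers 875 and 1351** (position `t₀ = 3`: `(0,3)` ↔ `(1,1)`; both rows in
the tree).  A value-generic point of this facet is outside `closure TwentyLocus` — (M) holds there with no sieve. [this work] -/
theorem mixedWall_not_mem_closure_chambers875_1351 (δ₀ : Fin 6 → ℝ) (hδ₀ : Monotone δ₀)
    (hmono : Monotone ((fun p : Fin 6 × Fin 6 => δ₀ p.1 + δ₀ p.2) ∘ chamber 875))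
    (htie : δ₀ (chamber 875 (3 : Fin 20).castSucc).1 + δ₀ (chamber 875 (3 : Fin 20).castSucc).2
        = δ₀ (chamber 875 (3 : Fin 20).succ).1 + δ₀ (chamber 875 (3 : Fin 20).succ).2)
    (hgen : ∀ a b : Fin 21, δ₀ (chamber 875 a).1 + δ₀ (chamber 875 a).2 = δ₀ (chamber 875 b).1 + δ₀ (chamber 875 b).2 →
      a = b ∨ (a = (3 : Fin 20).castSucc ∧ b = (3 : Fin 20).succ) ∨ (a = (3 : Fin 20).succ ∧ b = (3 : Fin 20).castSucc)) :
    δ₀ ∉ closure Bubbling.TwentyLocus :=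
  wallFacet_not_mem_closure_bubblingTwentyLocus_of_chambers 875 1351 3 (funext fun t => by fin_cases t <;> rfl) (by decide) (by decide)
    (fun d hd => doorA26_on_chamber875 d hd) (fun d hd => doorA26_on_chamber1351 d hd) δ₀ hδ₀ hmono htie hgen

end Summit.ValiantsHypothesis.ValiantsHypothesis.Theorems.LacunarySymmetroidMatrixDescartes.Census.RealExp
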